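import Mathlib.LinearAlgebra.FiniteDimensional.Basic
import Literature.NumberTheory.GaloisRepresentations.LubinTateTorsion
import HarnessLib

/-!
# The Lubin–Tate character at finite level: `Gal(K_π^{n+1}/F) ≃ (𝒪_F/π^{n+1})ˣ`

Step P3 of the Lubin–Tate programme of `LubinTate.lean` / `LubinTateTorsion.lean`.  For a
non-archimedean local field `F`, a uniformizer `π` and the Lubin–Tate series `f = πX + X^q`, the
file `LubinTateTorsion.lean` proves that `K_π^{n+1} = F(λ_{n+1})` (`ltField π n`) is an abelian
Galois extension of `F`, that the `π^{n+1}`-division points are exactly the `[a]_f λ_{n+1}`,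
`a ∈ 𝒪_F`, with `[a]λ = [b]λ ↔ a ≡ b (mod π^{n+1})`, and that every `F`-automorphism `σ` moves
`λ_{n+1}` to some `[u]λ_{n+1}`.  Here we package this as THE character of the theory
(Cassels–Fröhlich VI §3.6 Prop. 6 (b) with §3.4 Thm. 3 (b): "`G(K_π^n/K)` is isomorphic to
`U_K/U_K^{(n)}`"; Lubin–Tate 1965, Thm. 2 and Cor.), **fully proved**:

* `ltAct hπ n a x = [a]_f x` — the `𝒪_F`-action on the points `𝔪_{K_π^{n+1}}` (an abbreviation for
  the points module of `LubinTatePoints.lean` at `E = K_π^{n+1}`), and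
  `ltAct_genPt_eq_of_dvd_sub`: `a ≡ b (mod π^{n+1}) → [a]λ = [b]λ` (converse of the accepted
  `pow_dvd_sub_of_ltSMul_genPt_eq`).
* `exists_unit_mapPt_genPt`: every `σ ∈ Gal(K_π^{n+1}/F)` satisfies `σ λ_{n+1} = [u]λ_{n+1}` for a
  UNIT `u ∈ 𝒪_Fˣ` (a non-unit would make `σ λ_{n+1}` a `π^n`-division point, contradicting
  primitivity); `ltGalUnit hπ n σ` is a chosen such unit, unique modulo `π^{n+1}`.
* `mapPt_ltAct`: **`σ([b]λ) = [u_σ]([b]λ)`** — `σ` acts on EVERY `π^{n+1}`-division point through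
  the same unit (the `[a]_f` commute with `σ`, accepted `toUnitBallHom_ltSMul`, and with each other).
* `ltGalChar hπ n : Gal(K_π^{n+1}/F) →* (𝒪_F ⧸ (π^{n+1}))ˣ`, `σ ↦ u_σ mod π^{n+1}` — **the Lubin–Tate
  character of level `n+1`**: a group homomorphism (`u_{στ} ≡ u_σ u_τ`), characterised by
  `coe_ltGalChar_eq_iff` (`ltGalChar σ = ā ↔ σ λ = [a]λ`), **injective** (`ltGalChar_injective`: `σ` is
  determined by `σ λ`) and **surjective** (`ltGalChar_surjective`: for a unit `a`, `[a]λ` is again a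
  root of the Eisenstein polynomial `φ_{n+1} = minpoly λ`, so `λ ↦ [a]λ` extends to an automorphism),
  whence the isomorphism `ltGalCharEquiv hπ n : Gal(K_π^{n+1}/F) ≃* (𝒪_F ⧸ (π^{n+1}))ˣ`
  (Cassels–Fröhlich VI §3.4 Thm. 3 (b); there `U_K/U_K^{(n)} ≅ (𝒪/π^n)ˣ`).
* `ltAbsChar hπ n : Γ_F →* (𝒪_F ⧸ (π^{n+1}))ˣ` — the composite with the restriction
  `Γ_F → Gal(K_π^{n+1}/F)` (Mathlib's `AlgEquiv.restrictNormalHom`), with the action formula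
  `absGal_smul_ltAct` on the division points viewed in `F̄`.

What is NOT here (the sequel, "P4"): the tower `K_π^{n+1} ⊆ K_π^{n+2}`, the compatibility of the
`ltAbsChar hπ n` under reduction `𝒪/π^{n+2} → 𝒪/π^{n+1}`, and their limit, the continuous
character `χ_π : Γ_F →ₜ* 𝒪_Fˣ`; the reciprocity formula `Art(u)|_{K_π} = [u⁻¹]_f` (Lubin–Tate 1965
Thm. 3; Cassels–Fröhlich VI §3.7).

## References

* J.-P. Serre, *Local class field theory*, Ch. VI in Cassels–Fröhlich, *Algebraic Number Theory*
  (1967), §3.4 Thm. 3, §3.6 Prop. 6 (b) and its proof ("`E ↦ [u]E` … an injective homomorphism of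
  `G(K_π^n/K)` into `U_K/U_K^{(n)}` … by counting, an isomorphism").  [CasselsFrohlichANT1967]
* J. Lubin, J. Tate, *Formal complex multiplication in local fields*, Ann. of Math. 81 (1965),
  Thm. 2 and its Corollary (p. 383–384).  [LubinTate1965]

## Mathlib reuse

`PowerBasis.lift`, `PowerBasis.lift_gen`, `PowerBasis.algHom_ext`, `IntermediateField.adjoin.powerBasis`,
`IntermediateField.minpoly_gen`, `AlgEquiv.ofBijective`, `LinearMap.injective_iff_surjective`,
`AlgEquiv.restrictNormalHom`, `AlgEquiv.restrictNormal_commutes`, `Ideal.Quotient.eq`,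
`Ideal.mem_span_singleton`, `Units.map`; from the tree: `LubinTateTorsion.lean` (`genPt`, `mapPt`,
`toUnitBallHom_ltSMul`, `card_roots_ltPolyIter`, `pow_dvd_sub_of_ltSMul_genPt_eq`,
`aeval_gen_ltPolyIter_ne_zero`, `ltSMul_pow_genPt`, `isGalois_ltField`), `LubinTatePoints.lean`
(`add_ltSMul`, `mul_ltSMul`, `one_ltSMul`, `ltSMul_zero`, `ltAdd_zero`).
-/

noncomputable section

open Filter Topology Polynomial

namespace Literature.NumberTheory.GaloisRepresentations

section Concrete

open ValuativeRel GaloisRepresentations.IsNonarchimedeanLocalField LubinTate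

variable {F : Type*} [Field F] [ValuativeRel F] [TopologicalSpace F] [IsNonarchimedeanLocalField F]

section Normed

-- The normed-field instances on `F` and on the finite subextensions of `F̄` are those declared
-- (as local instances) in `LubinTateTorsion.lean`; they are re-activated here verbatim so that the
-- instances and definitions built there (`maxNilIdeal`, `genPt`, `mapPt`, …) apply.
attribute [local instance] instUniformSpace_literature rk1 nF nE

/-- (local) the uniform structure of `F` is a group uniformity. [folklore] -/
local instance ltCharIsUniformAddGroup : IsUniformAddGroup F := isUniformAddGroup_of_addCommGroup

variable {π : 𝒪[F]} (hπ : (valuation F).IsUniformizer (π : F))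

/-! ### The `𝒪_F`-action on the points of `𝔪_{K_π^{n+1}}` -/

/-- **`[a]_f x`** for a point `x` of `𝔪_{K_π^{n+1}}` and `a ∈ 𝒪_F`: the `𝒪_F`-module structure of
Cassels–Fröhlich VI §3.4 on the points of the Lubin–Tate formal group of `f = πX + X^q` in the
Lubin–Tate field `K_π^{n+1}` (abbreviation for the accepted `LubinTate.ltSMul` at
`E = ltField π n`, coefficients in the discrete copy `LTCoeff F` of `𝒪_F`).
[cite: CasselsFrohlichANT1967, Ch. VI §3.4] -/
abbrev ltAct (n : ℕ) (a : 𝒪[F]) (x : (maxNilIdeal F (ltField π n)).toIdeal) :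
    (maxNilIdeal F (ltField π n)).toIdeal :=
  ltSMul (maxNilIdeal F (ltField π n)) (isLTRing_LTCoeff hπ) (isLTSeries_LTCoeff π)
    (LTCoeff.of F a) x

/-- `[1] x = x`. [cite: LubinTate1965, §1 Thm. 1 (11)] -/
theorem ltAct_one (n : ℕ) (x : (maxNilIdeal F (ltField π n)).toIdeal) : ltAct hπ n 1 x = x := by
  rw [ltAct, map_one]
  exact one_ltSMul _ _ _ x

/-- `[a b] x = [a] ([b] x)`. [cite: LubinTate1965, §1 Thm. 1 (9)] -/
theorem ltAct_mul (n : ℕ) (a b : 𝒪[F]) (x : (maxNilIdeal F (ltField π n)).toIdeal) :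
    ltAct hπ n (a * b) x = ltAct hπ n a (ltAct hπ n b x) := by
  rw [ltAct, map_mul]
  exact mul_ltSMul _ _ _ _ _ x

/-- `[a] ([b] x) = [b] ([a] x)`: the endomorphisms `[a]_f` commute. [cite: LubinTate1965, §1 Thm. 1 (9)] -/
theorem ltAct_comm (n : ℕ) (a b : 𝒪[F]) (x : (maxNilIdeal F (ltField π n)).toIdeal) :
    ltAct hπ n a (ltAct hπ n b x) = ltAct hπ n b (ltAct hπ n a x) := by
  rw [← ltAct_mul, mul_comm, ltAct_mul]

/-- `[π^{n+1} c] λ_{n+1} = 0`. [cite: CasselsFrohlichANT1967, Ch. VI §3.6] -/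
theorem ltAct_pow_mul_genPt (n : ℕ) (c : 𝒪[F]) : ltAct hπ n (π ^ (n + 1) * c) (genPt hπ n) = 0 := by
  have h1 : ltAct hπ n (π ^ (n + 1)) (genPt hπ n) = 0 := by
    change ltSMul _ _ _ (LTCoeff.of F (π ^ (n + 1))) (genPt hπ n) = 0
    rw [map_pow]
    exact ltSMul_pow_genPt hπ n
  rw [mul_comm, ltAct_mul, h1]
  exact ltSMul_zero _ _ _ _

/-- **`a ≡ b (mod π^{n+1}) ⟹ [a] λ_{n+1} = [b] λ_{n+1}`** (`λ_{n+1}` is killed by `π^{n+1}`); with the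
accepted converse `pow_dvd_sub_of_ltSMul_genPt_eq` this is `E_f^{n+1} ≅ 𝒪/π^{n+1}`.
[cite: CasselsFrohlichANT1967, Ch. VI §3.6 Prop. 6 (a)] -/
theorem ltAct_genPt_eq_of_dvd_sub {n : ℕ} {a b : 𝒪[F]} (h : π ^ (n + 1) ∣ a - b) :
    ltAct hπ n a (genPt hπ n) = ltAct hπ n b (genPt hπ n) := by
  obtain ⟨c, hc⟩ := h
  have hab : a = b + π ^ (n + 1) * c := by rw [← hc]; ring
  rw [hab, ltAct, map_add, add_ltSMul]
  change ltAdd _ _ _ (ltAct hπ n b (genPt hπ n)) (ltAct hπ n (π ^ (n + 1) * c) (genPt hπ n)) = _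
  rw [ltAct_pow_mul_genPt]
  exact ltAdd_zero _ _ _ _

/-- `[a] λ_{n+1} = [b] λ_{n+1} ↔ a ≡ b (mod π^{n+1})`. [cite: CasselsFrohlichANT1967, Ch. VI §3.6 Prop. 6 (a)] -/
theorem ltAct_genPt_eq_iff {n : ℕ} {a b : 𝒪[F]} :
    ltAct hπ n a (genPt hπ n) = ltAct hπ n b (genPt hπ n) ↔ π ^ (n + 1) ∣ a - b :=
  ⟨pow_dvd_sub_of_ltSMul_genPt_eq hπ, ltAct_genPt_eq_of_dvd_sub hπ⟩

/-- **`[a] λ_{n+1}` is a PRIMITIVE `π^{n+1}`-division point iff `a` is a unit**: `f^{(n)}([a]λ) ≠ 0`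
for `a ∈ 𝒪_Fˣ` (as `f^{(n)}([a]λ) = [π^n a]λ` and `π^{n+1} ∤ π^n a`).
[cite: CasselsFrohlichANT1967, Ch. VI §3.6 Prop. 6 (proof)] -/
theorem aeval_ltAct_genPt_ltPolyIter_ne_zero (n : ℕ) (u : 𝒪[F]ˣ) :
    aeval (((ltAct hπ n (u : 𝒪[F]) (genPt hπ n) : unitBall (ltField π n)) : ltField π n))
      ((ltPolyIter F π n).map (algebraMap 𝒪[F] F)) ≠ 0 := by
  intro h0
  have h := coe_ltSMul_pow hπ (E := ltField π n) n (ltAct hπ n (u : 𝒪[F]) (genPt hπ n))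
  rw [h0] at h
  have h1 : ltSMul (maxNilIdeal F (ltField π n)) (isLTRing_LTCoeff hπ) (isLTSeries_LTCoeff π)
      (LTCoeff.of F π ^ n) (ltAct hπ n (u : 𝒪[F]) (genPt hπ n)) = 0 :=
    Subtype.ext (Subtype.ext h)
  have h2 : ltAct hπ n (π ^ n * u) (genPt hπ n) = 0 := by
    rw [ltAct_mul, ltAct, map_pow]; exact h1
  have h3 : π ^ (n + 1) ∣ π ^ n * (u : 𝒪[F]) := pow_dvd_of_ltSMul_genPt_eq_zero hπ h2
  rw [pow_succ] at h3
  have hπ0 : (π : 𝒪[F]) ^ n ≠ 0 := pow_ne_zero _ fun h => hπ.ne_zero (congrArg Subtype.val h)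
  have h4 : π ∣ (u : 𝒪[F]) := (mul_dvd_mul_iff_left hπ0).mp h3
  have h5 : IsUnit π := isUnit_of_dvd_unit h4 u.isUnit
  have h6 : valuation F (π : F) = 1 :=
    (Valuation.Integers.isUnit_iff_valuation_eq_one (Valuation.integer.integers (valuation F))).mp h5
  exact hπ.val_lt_one.ne h6

/-! ### Every automorphism acts on the division points through a unit -/

/-- **`σ λ_{n+1} = [u] λ_{n+1}` for a unit `u ∈ 𝒪_Fˣ`**, for every `σ ∈ Gal(K_π^{n+1}/F)`: `σ λ` is a
root of `f^{(n+1)}`, hence some `[a]λ` (accepted `card_roots_ltPolyIter`), and `a ∉ (π)` because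
`f^{(n)}(σ λ) = σ(f^{(n)}(λ)) ≠ 0` (primitivity, accepted `aeval_gen_ltPolyIter_ne_zero`).
[cite: CasselsFrohlichANT1967, Ch. VI §3.6 Prop. 6 (b)] -/
theorem exists_unit_mapPt_genPt (n : ℕ) (σ : ltField π n ≃ₐ[F] ltField π n) :
    ∃ u : 𝒪[F]ˣ, mapPt σ (genPt hπ n) = ltAct hπ n (u : 𝒪[F]) (genPt hπ n) := by
  classical
  obtain ⟨-, -, hroots⟩ := card_roots_ltPolyIter hπ n
  have hP0 : (((ltPolyIter F π (n + 1)).map (algebraMap 𝒪[F] F)).map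
      (algebraMap F (ltField π n))) ≠ 0 :=
    (((monic_ltPolyIter π (n + 1)).1.map _).map _).ne_zero
  -- `σ λ` is a root of `f^{(n+1)}`, hence some `[a] λ`
  obtain ⟨a, ha⟩ : ∃ a : 𝒪[F], σ (IntermediateField.AdjoinSimple.gen F (ltRoot π n)) =
      ((ltAct hπ n a (genPt hπ n) : unitBall (ltField π n)) : ltField π n) := by
    refine hroots _ ?_
    rw [Polynomial.mem_roots hP0, Polynomial.IsRoot.def, Polynomial.eval_map,
      ← Polynomial.aeval_def, Polynomial.aeval_algEquiv, AlgHom.coe_comp, Function.comp_apply]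
    change σ (aeval (IntermediateField.AdjoinSimple.gen F (ltRoot π n)) _) = 0
    rw [ltPolyIter_succ_eq_mul, Polynomial.map_mul, aeval_mul, ← minpoly_ltRoot π hπ n,
      IntermediateField.aeval_gen_minpoly, mul_zero, map_zero]
  -- `a` is a unit: otherwise `σ λ = [π a'] λ` would be killed by `f^{(n)}`
  have hunit : IsUnit a := by
    by_contra hna
    have hmem : a ∈ 𝓂[F] := (IsLocalRing.mem_maximalIdeal a).mpr hna
    obtain ⟨a', rfl⟩ := dvd_of_mem_maximalIdeal F hπ hmem
    -- `f^{(n)}([π a'] λ) = [π^n] [π a'] λ = 0`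
    have hkill : ltSMul (maxNilIdeal F (ltField π n)) (isLTRing_LTCoeff hπ) (isLTSeries_LTCoeff π)
        (LTCoeff.of F π ^ n) (ltAct hπ n (π * a') (genPt hπ n)) = 0 := by
      have e : ltAct hπ n (π ^ n) (ltAct hπ n (π * a') (genPt hπ n)) = 0 := by
        rw [← ltAct_mul, ← mul_assoc, ← pow_succ, ltAct_pow_mul_genPt]
      have e' : LTCoeff.of F (π ^ n) = LTCoeff.of F π ^ n := map_pow _ _ _
      rw [← e']
      exact e
    have hzero : aeval (σ (IntermediateField.AdjoinSimple.gen F (ltRoot π n)))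
        ((ltPolyIter F π n).map (algebraMap 𝒪[F] F)) = 0 := by
      rw [ha, ← coe_ltSMul_pow hπ (E := ltField π n) n, hkill]
      rfl
    -- transport along `σ`: `f^{(n)}(σ λ) = σ (f^{(n)}(λ))`, and `f^{(n)}(λ) ≠ 0`
    have hσ : aeval (σ (IntermediateField.AdjoinSimple.gen F (ltRoot π n)))
        ((ltPolyIter F π n).map (algebraMap 𝒪[F] F)) =
        σ (aeval (IntermediateField.AdjoinSimple.gen F (ltRoot π n))
          ((ltPolyIter F π n).map (algebraMap 𝒪[F] F))) := by
      rw [Polynomial.aeval_algEquiv]; rfl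
    rw [hσ] at hzero
    exact aeval_gen_ltPolyIter_ne_zero hπ (le_refl n)
      (σ.injective (hzero.trans (map_zero σ).symm))
  refine ⟨hunit.unit, Subtype.ext (Subtype.ext ?_)⟩
  rw [IsUnit.unit_spec, coe_mapPt]
  exact ha

/-- **The unit of `σ`**: a chosen `u_σ ∈ 𝒪_Fˣ` with `σ λ_{n+1} = [u_σ] λ_{n+1}` (well defined modulo
`π^{n+1}`, `dvd_sub_ltGalUnit_of_mapPt_eq`). [cite: CasselsFrohlichANT1967, Ch. VI §3.6 Prop. 6 (b)] -/
def ltGalUnit (n : ℕ) (σ : ltField π n ≃ₐ[F] ltField π n) : 𝒪[F]ˣ :=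
  Classical.choose (exists_unit_mapPt_genPt hπ n σ)

/-- `σ λ_{n+1} = [u_σ] λ_{n+1}`. [cite: CasselsFrohlichANT1967, Ch. VI §3.6 Prop. 6 (b)] -/
theorem mapPt_genPt (n : ℕ) (σ : ltField π n ≃ₐ[F] ltField π n) :
    mapPt σ (genPt hπ n) = ltAct hπ n (ltGalUnit hπ n σ : 𝒪[F]) (genPt hπ n) :=
  Classical.choose_spec (exists_unit_mapPt_genPt hπ n σ)

/-- Uniqueness of `u_σ` modulo `π^{n+1}`: if `σ λ = [a] λ` then `a ≡ u_σ`. [cite: CasselsFrohlichANT1967, Ch. VI §3.6 Prop. 6 (b)] -/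
theorem dvd_sub_ltGalUnit_of_mapPt_eq {n : ℕ} {σ : ltField π n ≃ₐ[F] ltField π n} {a : 𝒪[F]}
    (h : mapPt σ (genPt hπ n) = ltAct hπ n a (genPt hπ n)) :
    π ^ (n + 1) ∣ a - ltGalUnit hπ n σ :=
  (ltAct_genPt_eq_iff hπ).mp (h.symm.trans (mapPt_genPt hπ n σ))

/-- `σ ([b] x) = [b] (σ x)`: the Galois action commutes with `[b]_f` (accepted
`toUnitBallHom_ltSMul`, restated for `mapPt`). [cite: CasselsFrohlichANT1967, Ch. VI §3.6 Prop. 6 (b) (proof)] -/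
theorem mapPt_ltAct' (n : ℕ) (σ : ltField π n ≃ₐ[F] ltField π n) (b : 𝒪[F])
    (x : (maxNilIdeal F (ltField π n)).toIdeal) :
    mapPt σ (ltAct hπ n b x) = ltAct hπ n b (mapPt σ x) :=
  Subtype.ext (toUnitBallHom_ltSMul σ (LTCoeff.of F b) x)

/-- **`σ` acts on EVERY `π^{n+1}`-division point `[b] λ_{n+1}` as `[u_σ]`**:
`σ([b]λ) = [b](σλ) = [b][u_σ]λ = [u_σ]([b]λ)`. [cite: CasselsFrohlichANT1967, Ch. VI §3.6 Prop. 6 (b)] -/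
theorem mapPt_ltAct (n : ℕ) (σ : ltField π n ≃ₐ[F] ltField π n) (b : 𝒪[F]) :
    mapPt σ (ltAct hπ n b (genPt hπ n)) =
      ltAct hπ n (ltGalUnit hπ n σ : 𝒪[F]) (ltAct hπ n b (genPt hπ n)) := by
  rw [mapPt_ltAct', mapPt_genPt, ltAct_comm]

/-- `mapPt` is multiplicative: `(σ τ) x = σ (τ x)`. [folklore] -/
theorem mapPt_mul {E : IntermediateField F (AlgebraicClosure F)} [FiniteDimensional F E]
    (σ τ : E ≃ₐ[F] E) (x : (maxNilIdeal F E).toIdeal) : mapPt (σ * τ) x = mapPt σ (mapPt τ x) :=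
  rfl

/-- `mapPt 1 = id`. [folklore] -/
theorem mapPt_one {E : IntermediateField F (AlgebraicClosure F)} [FiniteDimensional F E]
    (x : (maxNilIdeal F E).toIdeal) : mapPt (1 : E ≃ₐ[F] E) x = x :=
  rfl

/-- `u_1 ≡ 1 (mod π^{n+1})`. [folklore] -/
theorem dvd_one_sub_ltGalUnit_one (n : ℕ) :
    π ^ (n + 1) ∣ 1 - (ltGalUnit hπ n (1 : ltField π n ≃ₐ[F] ltField π n) : 𝒪[F]) :=
  dvd_sub_ltGalUnit_of_mapPt_eq hπ (by rw [mapPt_one, ltAct_one])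

/-- **`u_{στ} ≡ u_σ u_τ (mod π^{n+1})`.** [cite: CasselsFrohlichANT1967, Ch. VI §3.6 Prop. 6 (b)] -/
theorem dvd_mul_sub_ltGalUnit_mul (n : ℕ) (σ τ : ltField π n ≃ₐ[F] ltField π n) :
    π ^ (n + 1) ∣ (ltGalUnit hπ n σ : 𝒪[F]) * ltGalUnit hπ n τ - ltGalUnit hπ n (σ * τ) :=
  dvd_sub_ltGalUnit_of_mapPt_eq hπ (by rw [mapPt_mul, mapPt_genPt hπ n τ, mapPt_ltAct, ltAct_mul])

/-! ### The character `Gal(K_π^{n+1}/F) →* (𝒪_F/π^{n+1})ˣ` -/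

/-- Reduction of units modulo `π^{n+1}`. [folklore] -/
abbrev unitsModPow (π : 𝒪[F]) (n : ℕ) : 𝒪[F]ˣ →* (𝒪[F] ⧸ Ideal.span {π ^ (n + 1)})ˣ :=
  Units.map (Ideal.Quotient.mk (Ideal.span {π ^ (n + 1)})).toMonoidHom

omit [TopologicalSpace F] [IsNonarchimedeanLocalField F] in
/-- Two units have the same reduction iff they are congruent. [folklore] -/
theorem unitsModPow_eq_iff {n : ℕ} {u v : 𝒪[F]ˣ} :
    unitsModPow π n u = unitsModPow π n v ↔ π ^ (n + 1) ∣ (u : 𝒪[F]) - v := by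
  rw [Units.ext_iff, Units.coe_map, Units.coe_map, RingHom.toMonoidHom_eq_coe, MonoidHom.coe_coe,
    Ideal.Quotient.eq, Ideal.mem_span_singleton]

/-- **The Lubin–Tate character of level `n+1`**, `σ ↦ u_σ mod π^{n+1}`:
`Gal(K_π^{n+1}/F) →* (𝒪_F ⧸ (π^{n+1}))ˣ`, where `σ x = [u_σ]_f x` for every `π^{n+1}`-division point
`x` (`mapPt_ltAct`).  Cassels–Fröhlich VI §3.6 Prop. 6 (b): "an injective homomorphism of
`G(K_π^n/K)` into `U_K/U_K^{(n)}`"; Lubin–Tate 1965, Cor. to Thm. 2.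
[cite: CasselsFrohlichANT1967, Ch. VI §3.6 Prop. 6 (b)] -/
def ltGalChar (n : ℕ) : (ltField π n ≃ₐ[F] ltField π n) →* (𝒪[F] ⧸ Ideal.span {π ^ (n + 1)})ˣ where
  toFun σ := unitsModPow π n (ltGalUnit hπ n σ)
  map_one' := by
    rw [← map_one (unitsModPow π n), unitsModPow_eq_iff, ← dvd_neg, neg_sub, Units.val_one]
    exact dvd_one_sub_ltGalUnit_one hπ n
  map_mul' σ τ := by
    rw [← map_mul, unitsModPow_eq_iff, ← dvd_neg, neg_sub, Units.val_mul]
    exact dvd_mul_sub_ltGalUnit_mul hπ n σ τ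

/-- Unfolding of `ltGalChar`. [folklore] -/
theorem ltGalChar_apply (n : ℕ) (σ : ltField π n ≃ₐ[F] ltField π n) :
    ltGalChar hπ n σ = unitsModPow π n (ltGalUnit hπ n σ) := rfl

/-- The value of the character as a residue class: `(ltGalChar σ : 𝒪/π^{n+1}) = u_σ mod π^{n+1}`. [folklore] -/
theorem coe_ltGalChar (n : ℕ) (σ : ltField π n ≃ₐ[F] ltField π n) :
    ((ltGalChar hπ n σ : (𝒪[F] ⧸ Ideal.span {π ^ (n + 1)})ˣ) : 𝒪[F] ⧸ Ideal.span {π ^ (n + 1)}) =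
      Ideal.Quotient.mk _ (ltGalUnit hπ n σ : 𝒪[F]) := rfl

/-- **Characterisation**: `ltGalChar σ = ā ↔ σ λ_{n+1} = [a] λ_{n+1}`.
[cite: CasselsFrohlichANT1967, Ch. VI §3.6 Prop. 6 (b)] -/
theorem coe_ltGalChar_eq_iff {n : ℕ} {σ : ltField π n ≃ₐ[F] ltField π n} {a : 𝒪[F]} :
    ((ltGalChar hπ n σ : (𝒪[F] ⧸ Ideal.span {π ^ (n + 1)})ˣ) : 𝒪[F] ⧸ Ideal.span {π ^ (n + 1)}) =
        Ideal.Quotient.mk _ a ↔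
      mapPt σ (genPt hπ n) = ltAct hπ n a (genPt hπ n) := by
  rw [coe_ltGalChar, Ideal.Quotient.eq, Ideal.mem_span_singleton, mapPt_genPt, ltAct_genPt_eq_iff]

/-- **The action formula**: if `ltGalChar σ = ā` then `σ([b]λ) = [a]([b]λ)` for every division point.
[cite: CasselsFrohlichANT1967, Ch. VI §3.6 Prop. 6 (b)] -/
theorem mapPt_ltAct_of_coe_ltGalChar_eq {n : ℕ} {σ : ltField π n ≃ₐ[F] ltField π n} {a : 𝒪[F]}
    (h : ((ltGalChar hπ n σ : (𝒪[F] ⧸ Ideal.span {π ^ (n + 1)})ˣ) : 𝒪[F] ⧸ Ideal.span {π ^ (n + 1)}) =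
      Ideal.Quotient.mk _ a) (b : 𝒪[F]) :
    mapPt σ (ltAct hπ n b (genPt hπ n)) = ltAct hπ n a (ltAct hπ n b (genPt hπ n)) := by
  rw [mapPt_ltAct', (coe_ltGalChar_eq_iff hπ).mp h, ltAct_comm]

/-- The action formula in the field `K_π^{n+1}`: `σ ([b]λ) = [u_σ]([b]λ)` as elements of `K_π^{n+1}`. [cite: CasselsFrohlichANT1967, Ch. VI §3.6 Prop. 6 (b)] -/
theorem algEquiv_apply_ltAct (n : ℕ) (σ : ltField π n ≃ₐ[F] ltField π n) (b : 𝒪[F]) :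
    σ (((ltAct hπ n b (genPt hπ n) : unitBall (ltField π n)) : ltField π n)) =
      ((ltAct hπ n (ltGalUnit hπ n σ : 𝒪[F]) (ltAct hπ n b (genPt hπ n)) : unitBall (ltField π n)) :
        ltField π n) := by
  rw [← coe_mapPt, mapPt_ltAct]

/-- **`ltGalChar` is injective**: an automorphism is determined by its effect on the generator
`λ_{n+1}`. [cite: CasselsFrohlichANT1967, Ch. VI §3.6 Prop. 6 (b)] -/
theorem ltGalChar_injective (n : ℕ) : Function.Injective (ltGalChar hπ n) := by
  intro σ τ hστ
  have hint := isIntegral_ltRoot π n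
  have h : mapPt σ (genPt hπ n) = mapPt τ (genPt hπ n) := by
    rw [mapPt_genPt, mapPt_genPt, ltAct_genPt_eq_iff, ← unitsModPow_eq_iff]
    exact hστ
  apply AlgEquiv.coe_toAlgHom_injective
  refine (IntermediateField.adjoin.powerBasis hint).algHom_ext ?_
  change σ (IntermediateField.AdjoinSimple.gen F (ltRoot π n)) =
    τ (IntermediateField.AdjoinSimple.gen F (ltRoot π n))
  have h' := congrArg (fun y : (maxNilIdeal F (ltField π n)).toIdeal =>
    ((y : unitBall (ltField π n)) : ltField π n)) h
  exact h'

/-- For a unit `u`, `[u] λ_{n+1}` is a root of the Eisenstein polynomial `φ_{n+1} = minpoly_F λ_{n+1}`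
(it is a root of `f^{(n+1)} = f^{(n)} φ_{n+1}` and not of `f^{(n)}`).
[cite: CasselsFrohlichANT1967, Ch. VI §3.6 Prop. 6 (proof)] -/
theorem aeval_ltAct_genPt_minpoly (n : ℕ) (u : 𝒪[F]ˣ) :
    aeval (((ltAct hπ n (u : 𝒪[F]) (genPt hπ n) : unitBall (ltField π n)) : ltField π n))
      (minpoly F (ltRoot π n)) = 0 := by
  have h := aeval_ltSMul_genPt_ltPolyIter hπ n (u : 𝒪[F])
  rw [ltPolyIter_succ_eq_mul, Polynomial.map_mul, aeval_mul, mul_eq_zero] at h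
  rcases h with h | h
  · exact absurd h (aeval_ltAct_genPt_ltPolyIter_ne_zero hπ n u)
  · rwa [minpoly_ltRoot π hπ n]

/-- **`ltGalChar` is surjective**: for a unit `u`, `λ_{n+1} ↦ [u] λ_{n+1}` extends to an
`F`-automorphism of `K_π^{n+1} = F(λ_{n+1})` (a root of the minimal polynomial; `PowerBasis.lift`,
and an injective endomorphism of a finite extension is bijective).
[cite: CasselsFrohlichANT1967, Ch. VI §3.6 Prop. 6 (b)] -/
theorem ltGalChar_surjective (n : ℕ) : Function.Surjective (ltGalChar hπ n) := by
  intro c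
  set E := ltField π n
  have hint := isIntegral_ltRoot π n
  set pb := IntermediateField.adjoin.powerBasis hint with hpb
  -- a unit representative of `c`
  obtain ⟨a, ha⟩ := Ideal.Quotient.mk_surjective (c : 𝒪[F] ⧸ Ideal.span {π ^ (n + 1)})
  have hunit : IsUnit a := by
    by_contra hna
    have hmem : a ∈ 𝓂[F] := (IsLocalRing.mem_maximalIdeal a).mpr hna
    obtain ⟨a', rfl⟩ := dvd_of_mem_maximalIdeal F hπ hmem
    obtain ⟨b, hb⟩ := Ideal.Quotient.mk_surjective (↑c⁻¹ : 𝒪[F] ⧸ Ideal.span {π ^ (n + 1)})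
    have h1 : Ideal.Quotient.mk (Ideal.span {π ^ (n + 1)}) (π * a' * b) = 1 := by
      rw [map_mul, ha, hb, Units.mul_inv]
    rw [← map_one (Ideal.Quotient.mk (Ideal.span {π ^ (n + 1)})), Ideal.Quotient.eq,
      Ideal.mem_span_singleton] at h1
    have h2 : π ∣ π * a' * b - 1 := (dvd_pow_self π (Nat.succ_ne_zero n)).trans h1
    have h3 : π ∣ (1 : 𝒪[F]) := by
      have : π ∣ π * a' * b := ⟨a' * b, by ring⟩
      simpa using (dvd_sub this h2)
    have h5 : IsUnit π := isUnit_of_dvd_one h3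
    have h6 : valuation F (π : F) = 1 :=
      (Valuation.Integers.isUnit_iff_valuation_eq_one (Valuation.integer.integers (valuation F))).mp h5
    exact hπ.val_lt_one.ne h6
  set u : 𝒪[F]ˣ := hunit.unit
  set y : E := ((ltAct hπ n (u : 𝒪[F]) (genPt hπ n) : unitBall E) : E) with hy
  have hroot : aeval y (minpoly F pb.gen) = 0 := by
    rw [hpb, IntermediateField.adjoin.powerBasis_gen, IntermediateField.minpoly_gen]
    exact aeval_ltAct_genPt_minpoly hπ n u
  set φ : E →ₐ[F] E := pb.lift y hroot
  have hφ : φ pb.gen = y := pb.lift_gen y hroot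
  have hbij : Function.Bijective φ :=
    ⟨φ.toRingHom.injective, LinearMap.injective_iff_surjective.mp φ.toRingHom.injective⟩
  refine ⟨AlgEquiv.ofBijective φ hbij, Units.ext ?_⟩
  rw [← ha, coe_ltGalChar_eq_iff]
  apply Subtype.ext; apply Subtype.ext
  rw [coe_mapPt]
  change φ (IntermediateField.AdjoinSimple.gen F (ltRoot π n)) = _
  rw [← IntermediateField.adjoin.powerBasis_gen hint, hφ, hy, IsUnit.unit_spec]

/-- **`Gal(K_π^{n+1}/F) ≃* (𝒪_F ⧸ (π^{n+1}))ˣ`** — the Lubin–Tate character of level `n+1` is an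
isomorphism (Cassels–Fröhlich VI §3.4 Thm. 3 (b), §3.6 Prop. 6 (b); Lubin–Tate 1965, Cor. to
Thm. 2).  In particular `[K_π^{n+1} : F] = #(𝒪/π^{n+1})ˣ = (q-1)q^n`, in accordance with the accepted
`finrank_ltField`. [cite: CasselsFrohlichANT1967, Ch. VI §3.4 Thm. 3 (b)] -/
def ltGalCharEquiv (n : ℕ) : (ltField π n ≃ₐ[F] ltField π n) ≃* (𝒪[F] ⧸ Ideal.span {π ^ (n + 1)})ˣ :=
  MulEquiv.ofBijective (ltGalChar hπ n) ⟨ltGalChar_injective hπ n, ltGalChar_surjective hπ n⟩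

/-- `ltGalCharEquiv` is `ltGalChar` (unfolding). [folklore] -/
theorem ltGalCharEquiv_apply (n : ℕ) (σ : ltField π n ≃ₐ[F] ltField π n) :
    ltGalCharEquiv hπ n σ = ltGalChar hπ n σ := rfl

/-! ### The character on the absolute Galois group -/

/-- **The Lubin–Tate character of level `n+1` on `Γ_F`**: `Γ_F → Gal(K_π^{n+1}/F) → (𝒪_F/π^{n+1})ˣ`
(restriction to the normal extension `K_π^{n+1}/F`, Mathlib's `AlgEquiv.restrictNormalHom`, then
`ltGalChar`). [cite: CasselsFrohlichANT1967, Ch. VI §3.6 Prop. 6 (b)] -/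
def ltAbsChar (n : ℕ) : Field.absoluteGaloisGroup F →* (𝒪[F] ⧸ Ideal.span {π ^ (n + 1)})ˣ :=
  haveI := isGalois_ltField hπ n
  (ltGalChar hπ n).comp ((AlgEquiv.restrictNormalHom (F := F) (K₁ := AlgebraicClosure F) (ltField π n)).comp
    (Field.absoluteGaloisGroup.toAlgEquiv F).toMonoidHom)

/-- Unfolding of `ltAbsChar`. [folklore] -/
theorem ltAbsChar_apply (n : ℕ) (σ : Field.absoluteGaloisGroup F) :
    ltAbsChar hπ n σ =
      haveI := isGalois_ltField hπ n
      ltGalChar hπ n (AlgEquiv.restrictNormalHom (ltField π n)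
        (Field.absoluteGaloisGroup.toAlgEquiv F σ)) := rfl

/-- `ltAbsChar` is onto (restriction to a normal subextension of `F̄` is onto, and `ltGalChar` is).
[cite: CasselsFrohlichANT1967, Ch. VI §3.6 Prop. 6 (b)] -/
theorem ltAbsChar_surjective (n : ℕ) : Function.Surjective (ltAbsChar hπ n) := by
  haveI := isGalois_ltField hπ n
  exact (ltGalChar_surjective hπ n).comp
    ((AlgEquiv.restrictNormalHom_surjective (F := F) (K₁ := ltField π n) (E := AlgebraicClosure F)).comp
      (Field.absoluteGaloisGroup.toAlgEquiv F).surjective)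

/-- **The action of `Γ_F` on the division points in `F̄`**: if `ltAbsChar σ = ā` then
`σ • [b]λ_{n+1} = [a]([b]λ_{n+1})` in `F̄` for every `b ∈ 𝒪_F`.
[cite: CasselsFrohlichANT1967, Ch. VI §3.6 Prop. 6 (b)] -/
theorem absGal_smul_ltAct_of_coe_ltAbsChar_eq {n : ℕ} {σ : Field.absoluteGaloisGroup F} {a : 𝒪[F]}
    (h : ((ltAbsChar hπ n σ : (𝒪[F] ⧸ Ideal.span {π ^ (n + 1)})ˣ) : 𝒪[F] ⧸ Ideal.span {π ^ (n + 1)}) =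
      Ideal.Quotient.mk _ a) (b : 𝒪[F]) :
    σ • ((((ltAct hπ n b (genPt hπ n) : unitBall (ltField π n)) : ltField π n) : AlgebraicClosure F)) =
      (((ltAct hπ n a (ltAct hπ n b (genPt hπ n)) : unitBall (ltField π n)) : ltField π n) :
        AlgebraicClosure F) := by
  haveI := isGalois_ltField hπ n
  rw [ltAbsChar_apply] at h
  have key := mapPt_ltAct_of_coe_ltGalChar_eq hπ h b
  have key' := congrArg (fun y : (maxNilIdeal F (ltField π n)).toIdeal =>
    (((y : unitBall (ltField π n)) : ltField π n) : AlgebraicClosure F)) key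
  simp only [coe_mapPt] at key'
  rw [← key', Field.absoluteGaloisGroup.smul_def]
  exact (AlgEquiv.restrictNormal_commutes (Field.absoluteGaloisGroup.toAlgEquiv F σ) (ltField π n) _).symm

/-- The same for the chosen unit: `σ • [b]λ_{n+1} = [u]([b]λ_{n+1})` in `F̄` with
`u = ltGalUnit (σ|_{K_π^{n+1}})`. [cite: CasselsFrohlichANT1967, Ch. VI §3.6 Prop. 6 (b)] -/
theorem absGal_smul_ltAct (n : ℕ) (σ : Field.absoluteGaloisGroup F) (b : 𝒪[F]) :
    haveI := isGalois_ltField hπ n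
    σ • ((((ltAct hπ n b (genPt hπ n) : unitBall (ltField π n)) : ltField π n) : AlgebraicClosure F)) =
      (((ltAct hπ n (ltGalUnit hπ n (AlgEquiv.restrictNormalHom (ltField π n)
          (Field.absoluteGaloisGroup.toAlgEquiv F σ)) : 𝒪[F])
        (ltAct hπ n b (genPt hπ n)) : unitBall (ltField π n)) : ltField π n) : AlgebraicClosure F) :=
  absGal_smul_ltAct_of_coe_ltAbsChar_eq hπ rfl b

end Normed

end Concrete

end Literature.NumberTheory.GaloisRepresentations

end
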